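import Literature.NumberTheory.GaloisRepresentations.RestrictedRamificationBaseChange
import Literature.NumberTheory.GaloisCohomology.RestrictedRamificationFiniteCohomologyBaseChange
import Literature.NumberTheory.GaloisCohomology.RestrictedRamificationPoitouTateThreeLeTotallyComplex
import Literature.NumberTheory.GaloisRepresentations.IndexCoprimeTransfer
import Literature.NumberTheory.GaloisRepresentations.ContinuousCohomologyMulEquivTransport
import Literature.GroupTheory.ProfiniteSubquotients
import Mathlib.NumberTheory.Cyclotomic.Gal
import HarnessLib

/-!
# NSW (8.3.18) / Harari Cor. 17.14 at EVERY number field: `cd_p G_{K,S} ≤ 2` (`p` odd if `K` has a real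
# place) — the named fact `groupCdLE_two_galoisGroupUnramifiedOutside K` DISCHARGED, by base change to the
# totally complex cyclotomic layer `K(ζ_p) ⊆ K_S` of degree prime to `p`

Topic `NumberTheory/GaloisCohomology`; namespace `Literature.NumberTheory.GaloisCohomology`.  THEOREMS ONLY
(no definition, no named fact, no `sorry`, no instance; D-0026).  Width seat `bsd-line-x2-p2` g15 of cell
`bsd-eis` (crux 4 `BSDpOnCellC`, stmt-BirchSwinnertonDyer-19034; `--supports`); sequel of
`RestrictedRamificationFiniteCohomologyBaseChange` (same method, vanishing instead of finiteness; its
`isTotallyComplex_of_isPrimitiveRoot` is reused).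

PRINT (Neukirch–Schmidt–Wingberg (8.3.18)): "`cd_p G_S ≤ 2` if `p ≠ 2` or `k` is totally imaginary" (for
`S ⊇ S_p`; Harari Cor. 17.14).  The tree proves the totally complex case for every `p`
(`groupCdLE_two_galoisGroupUnramifiedOutside_of_isTotallyComplex`, lane «PT3-TC»: `H³(U, μ_p) = 0` from the
`S`-unit class formation).  For `K` with a real place and `p` odd, NSW's own reduction applies: `L = K(ζ_p)`
is totally complex, lies in `K_S` (`S ⊇ S_p`), and `[L : K] ∣ p − 1` is prime to `p`; the open subgroup
`U = Gal(K_S/L) ≤ G_{K,S}` is `≃ₜ* G_{L,S_L}` (`exists_continuousMulEquiv_galoisGroupUnramifiedOutside`),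
so `H^q(U, A) = 0` for `q ≥ 3` and `p`-primary `A` (cd at `L`, transported along the isomorphism by
`nonempty_continuousCohomology_addEquiv_of_continuousMulEquiv`), and restriction to a subgroup of index prime
to `p` is injective on `p`-primary cohomology (Serre I §3.3 Prop. 14; tree
`subsingleton_of_isOpen_of_index_coprime`), whence `H^q(G_{K,S}, A) = 0`.

* `finrank_cyclotomicField_dvd_sub_one` — `[K(ζ_p) : K] ∣ p − 1` (`Gal(K(ζ_p)/K) ↪ (ℤ/p)ˣ`, Mathlib
  `IsPrimitiveRoot.autToPow_injective`);
  `ramificationSubgroup_le_range_absGaloisRestrict_cyclotomicField_prime` — `K(ζ_p) ⊆ K_S` for `S ⊇ S_p`;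
* `index_map_toUnramifiedQuot_range_absGaloisRestrict_dvd` — `[G_{K,S} : Gal(K_S/L)] ∣ [L : K]`;
* **`groupCdLE_two_galoisGroupUnramifiedOutside_holds (K) : groupCdLE_two_galoisGroupUnramifiedOutside K`**
  and its `∀`-closed form.

HONEST FRAMING: a textbook theorem (NSW (8.3.18)) now proved at every number field from landed theorems of
the tree; no statement of any Summit, no case of BSD, no crux and no stub is proved here; 0 cells / labels /
tiers move.

## References
* J. Neukirch, A. Schmidt, K. Wingberg, *Cohomology of Number Fields*, 2nd ed. (2008), (8.3.18) and its
  proof ((3.3.2), (3.3.5)). [NeukirchSchmidtWingberg2008]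
* D. Harari, *Galois Cohomology and Class Field Theory* (2020), Cor. 17.14 (p. 295). [Harari2020]
* J.-P. Serre, *Cohomologie galoisienne* (1994), I §3.3 Prop. 14 and Cor. 1. [SerreGaloisCohomology1997]
-/

noncomputable section

open CategoryTheory Function NumberField Field IsDedekindDomain Topology
open scoped NumberField

namespace Literature.NumberTheory.GaloisCohomology

open Literature.NumberTheory.GaloisRepresentations
open _root_.TopRep _root_.ContRepresentation _root_.ContinuousCohomology

/-! ### §1. Degree and index bookkeeping for the cyclotomic layer `K(ζ_p)` -/

section Degree

variable (K : Type) [Field K] [NumberField K] (p : ℕ) [hp : Fact p.Prime]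

/-- **`[K(ζ_p) : K] ∣ p − 1`**: `K(ζ_p)/K` is Galois with group embedding into `(ℤ/p)ˣ`
(Mathlib `IsPrimitiveRoot.autToPow_injective`, `IsGalois.card_aut_eq_finrank`, `ZMod.card_units`).
[cite: NeukirchANT1999, Ch. I §10 (cyclotomic fields)] -/
theorem finrank_cyclotomicField_dvd_sub_one :
    Module.finrank K (CyclotomicField p K) ∣ p - 1 := by
  haveI : NeZero ((p : ℕ) : CyclotomicField p K) := ⟨by exact_mod_cast hp.out.ne_zero⟩
  haveI : NeZero p := ⟨hp.out.ne_zero⟩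
  have hζ := IsCyclotomicExtension.zeta_spec p K (CyclotomicField p K)
  haveI : IsGalois K (CyclotomicField p K) := IsCyclotomicExtension.isGalois {p} K (CyclotomicField p K)
  haveI : FiniteDimensional K (CyclotomicField p K) :=
    IsCyclotomicExtension.finite {p} K (CyclotomicField p K)
  have hcard := Subgroup.card_dvd_of_injective (hζ.autToPow K) (hζ.autToPow_injective K)
  rw [IsGalois.card_aut_eq_finrank, Nat.card_eq_fintype_card, ZMod.card_units] at hcard
  exact hcard

/-- **`[K(ζ_p) : K]` is prime to `p`.** [cite: NeukirchSchmidtWingberg2008, (8.3.18) (proof)] -/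
theorem finrank_cyclotomicField_coprime :
    (Module.finrank K (CyclotomicField p K)).Coprime p :=
  Nat.Coprime.coprime_dvd_left (finrank_cyclotomicField_dvd_sub_one K p)
    ((Nat.coprime_self_sub_left hp.out.one_le).mpr (Nat.coprime_one_left p))

/-- **`K(ζ_p) ⊆ K_S` for `S ⊇ S_p`**: the ramification subgroup `N_S(K)` lies in the image of
`Γ_{K(ζ_p)} → Γ_K` (it fixes the copy of `K(ζ_p)` in `K̄`, generated over `K` by `p`-th roots of unity, each
fixed by `N_S`: tree `smul_eq_self_of_mem_ramificationSubgroup_of_pow_eq_one`, `exists_mem_range_absGaloisRestrict_iff`).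
[cite: NeukirchSchmidtWingberg2008, VIII §3 (proof of (8.3.11): `k(μ_p) ⊆ k_S`)] -/
theorem ramificationSubgroup_le_range_absGaloisRestrict_cyclotomicField_prime
    {S : Set (HeightOneSpectrum (𝓞 K))}
    (hSp : ∀ v : HeightOneSpectrum (𝓞 K), ((p : ℕ) : 𝓞 K) ∈ v.asIdeal → v ∈ S) :
    ramificationSubgroup K S ≤ (absGaloisRestrict K (CyclotomicField p K)).range := by
  obtain ⟨e, he⟩ := exists_mem_range_absGaloisRestrict_iff K (CyclotomicField p K)
  intro g hg
  rw [he g]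
  intro x
  have hx := IsCyclotomicExtension.adjoin_roots (S := {p}) (A := K) (B := CyclotomicField p K) x
  induction hx using Algebra.adjoin_induction with
  | mem b hb =>
    obtain ⟨n, hn, -, hbn⟩ := hb
    rw [Set.mem_singleton_iff] at hn
    subst hn
    have hpow : (e b) ^ n ^ 1 = 1 := by rw [pow_one, ← map_pow, hbn, map_one]
    exact smul_eq_self_of_mem_ramificationSubgroup_of_pow_eq_one (K := K) hSp hpow hg
  | algebraMap r =>
    rw [AlgHom.commutes, absoluteGaloisGroup.smul_def]
    exact (absoluteGaloisGroup.toAlgEquiv K g).commutes r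
  | add x y _ _ hx hy => rw [map_add, smul_add, hx, hy]
  | mul x y _ _ hx hy => rw [map_mul, smul_mul', hx, hy]

end Degree

section Index

variable {K : Type} [Field K] [NumberField K] (L : Type) [Field L] [Algebra K L] [FiniteDimensional K L]
  (S : Set (HeightOneSpectrum (𝓞 K)))

/-- **`[Γ_K : res Γ_L] = [L : K]`** for `L/K` finite (the image of `Γ_L → Γ_K` is the fixing subgroup of the
copy `e(L) ⊆ K̄`; Mathlib `IntermediateField.finrank_eq_fixingSubgroup_index`).  (Same statement as the tree's
`index_range_absGaloisRestrict_eq_finrank` of `ArtinFormalismInductionProofs`, re-proved here to keep the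
import light.) [cite: NeukirchANT1999, Ch. IV §1 (infinite Galois theory)] -/
theorem index_range_absGaloisRestrict_eq_finrank' :
    ((absGaloisRestrict K L).range : Subgroup (absoluteGaloisGroup K)).index = Module.finrank K L := by
  obtain ⟨e, he⟩ := exists_mem_range_absGaloisRestrict_iff K L
  have hK' : ((absGaloisRestrict K L).range : Subgroup (absoluteGaloisGroup K)) =
      (e.fieldRange.fixingSubgroup : Subgroup (absoluteGaloisGroup K)) := by
    ext g
    refine (he g).trans (Iff.trans ?_ (mem_fixingSubgroup_iff_forall_smul e.fieldRange g).symm)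
    constructor
    · rintro h ⟨x, ⟨k, rfl⟩⟩
      exact h k
    · intro h k
      exact h ⟨e k, ⟨k, rfl⟩⟩
  haveI : FiniteDimensional K e.fieldRange :=
    LinearEquiv.finiteDimensional e.equivFieldRange.toLinearEquiv
  rw [hK', e.equivFieldRange.toLinearEquiv.finrank_eq]
  exact (IntermediateField.finrank_eq_fixingSubgroup_index e.fieldRange).symm

/-- **`[G_{K,S} : Gal(K_S/L)] ∣ [L : K]`** (the image in `G_{K,S}` of `res Γ_L`; equality when `L ⊆ K_S`).
[cite: NeukirchSchmidtWingberg2008, VIII §3] -/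
theorem index_map_toUnramifiedQuot_range_absGaloisRestrict_dvd :
    (((absGaloisRestrict K L).range).map (toUnramifiedQuot K S) :
        Subgroup (GaloisGroupUnramifiedOutside K S)).index ∣ Module.finrank K L := by
  rw [← index_range_absGaloisRestrict_eq_finrank' L]
  exact Subgroup.index_map_dvd _ (toUnramifiedQuot_surjective K S)

end Index

/-! ### §2. The named fact at every number field -/

section Holds

variable (K : Type) [Field K] [NumberField K]

/-- **NSW (8.3.18) / HARARI COR. 17.14 AT EVERY NUMBER FIELD**: the named fact
`groupCdLE_two_galoisGroupUnramifiedOutside K` — for `S ⊇ S_p`, and `p ≠ 2` if `K` has a real place,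
`cd_p G_{K,S} ≤ 2` (`H^q(G_{K,S}, A) = 0` for `q ≥ 3` and every discrete `p`-primary `G_{K,S}`-module `A`) —
HOLDS.  (Totally complex `K`: the tree's theorem; otherwise `p` is odd and the statement descends from the
totally complex `L = K(ζ_p) ⊆ K_S` of degree prime to `p`: `H^q(Gal(K_S/L), A) ≅ H^q(G_{L,S_L}, A) = 0` and
restriction to a subgroup of index prime to `p` is injective on `p`-primary cohomology.)
[cite: NeukirchSchmidtWingberg2008, (8.3.18)] [cite: Harari2020, Cor. 17.14 (p. 295)]
[cite: SerreGaloisCohomology1997, I §3.3 Prop. 14] -/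
theorem groupCdLE_two_galoisGroupUnramifiedOutside_holds : groupCdLE_two_galoisGroupUnramifiedOutside K := by
  intro S p hp hSp hreal
  classical
  by_cases hTC : IsTotallyComplex K
  · exact groupCdLE_two_galoisGroupUnramifiedOutside_of_isTotallyComplex (K := K) S p hSp hreal
  -- `K` has a real place, so `p` is odd
  have hp2 : p ≠ 2 := by
    refine hreal ?_
    by_contra h
    exact hTC ⟨fun w => InfinitePlace.not_isReal_iff_isComplex.mp fun hw => h ⟨w, hw⟩⟩
  have hp3 : 2 < p := lt_of_le_of_ne hp.out.two_le (Ne.symm hp2)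
  -- the cyclotomic layer `L = K(ζ_p)`: totally complex, inside `K_S`, of degree prime to `p`
  let L := CyclotomicField p K
  haveI : NeZero ((p : ℕ) : L) := ⟨by exact_mod_cast hp.out.ne_zero⟩
  have hζ := IsCyclotomicExtension.zeta_spec p K L
  haveI : IsTotallyComplex L := isTotallyComplex_of_isPrimitiveRoot hζ hp3
  haveI : FiniteDimensional K L := IsCyclotomicExtension.finite {p} K L
  haveI : Algebra.IsAlgebraic K L := Algebra.IsAlgebraic.of_finite K L
  have hKS : ramificationSubgroup K S ≤ (absGaloisRestrict K L).range :=
    ramificationSubgroup_le_range_absGaloisRestrict_cyclotomicField_prime K p hSp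
  haveI : TotallyDisconnectedSpace (GaloisGroupUnramifiedOutside K S) :=
    Literature.GroupTheory.ProfiniteSubquotients.totallyDisconnectedSpace_quotient
      (ramificationSubgroup K S) (ramificationSubgroup_isClosed K S)
  -- the open subgroup `U = Gal(K_S/L)`, of index prime to `p`, and `e : G_{L,S_L} ≃ₜ* U`
  set U : Subgroup (GaloisGroupUnramifiedOutside K S) :=
    ((absGaloisRestrict K L).range).map (toUnramifiedQuot K S) with hUdef
  have hU : IsOpen (U : Set (GaloisGroupUnramifiedOutside K S)) :=
    isOpen_map_toUnramifiedQuot_range_absGaloisRestrict L S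
  haveI : CompactSpace U :=
    isCompact_iff_compactSpace.mp (Subgroup.isClosed_of_isOpen U hU).isCompact
  have hidx : U.index.Coprime p :=
    Nat.Coprime.coprime_dvd_left (index_map_toUnramifiedQuot_range_absGaloisRestrict_dvd L S)
      (finrank_cyclotomicField_coprime K p)
  obtain ⟨e, -⟩ := exists_continuousMulEquiv_galoisGroupUnramifiedOutside L S hKS
  -- `S_L ⊇ S_p(L)`
  have hSpL : ∀ w : HeightOneSpectrum (𝓞 L), ((p : ℕ) : 𝓞 L) ∈ w.asIdeal →
      w ∈ {w : HeightOneSpectrum (𝓞 L) | w.under (𝓞 K) ∈ S} :=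
    fun w hw => under_mem_of_natCast_mem L hSp w hw
  have hcdL := groupCdLE_two_galoisGroupUnramifiedOutside_of_isTotallyComplex (K := L)
    {w : HeightOneSpectrum (𝓞 L) | w.under (𝓞 K) ∈ S} p hSpL
    (fun ⟨w, hw⟩ => absurd hw (InfinitePlace.not_isReal_iff_isComplex.2 (IsTotallyComplex.isComplex w)))
  -- the vanishing
  intro M _ _ _ ρ hM q hq
  obtain ⟨n, rfl⟩ : ∃ n, q = n + 1 := ⟨q - 1, by omega⟩
  refine subsingleton_of_isOpen_of_index_coprime ρ hM hU hidx n ?_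
  -- `H^{n+1}(U, A) ≅ H^{n+1}(G_{L,S_L}, A) = 0`
  let τ : ContinuousRep (GaloisGroupUnramifiedOutside L {w : HeightOneSpectrum (𝓞 L) | w.under (𝓞 K) ∈ S}) ℤ M :=
    (ρ.restrict (subgroupIncl U)).restrict (e : _ →ₜ* U)
  haveI : Subsingleton (continuousCohomology (n + 1) τ.toTopRep) := hcdL M τ hM hq
  obtain ⟨iso⟩ := nonempty_continuousCohomology_addEquiv_of_continuousMulEquiv e
    (ρ.restrict (subgroupIncl U)) τ (fun _ _ => rfl) (n + 1)
  exact iso.symm.toEquiv.subsingleton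

/-- `∀`-closed form: **NSW (8.3.18) holds at every number field.** [cite: NeukirchSchmidtWingberg2008, (8.3.18)]
[cite: Harari2020, Cor. 17.14] -/
theorem forall_groupCdLE_two_galoisGroupUnramifiedOutside :
    ∀ (F : Type) [Field F] [NumberField F], groupCdLE_two_galoisGroupUnramifiedOutside F :=
  fun F _ _ => groupCdLE_two_galoisGroupUnramifiedOutside_holds F

end Holds

end Literature.NumberTheory.GaloisCohomology

end
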